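import Summits.CriticalPhenomena.PercolationContinuityZ3.Theorems.PercNearOneGluingNoHeavyLowerTailSahiGridPatternLiteralOrIdentity
import Summits.CriticalPhenomena.PercolationContinuityZ3.Theorems.PercNearOneGluingNoHeavyLowerTailSahiGridPatternTwoPayerSections

/-!
# `NoHeavyLowerTail` (crux stmt-CriticalPhenomena-4575), Sahi programme P1: **THE TWO-PAYER OR STAR WHEN BOTH SETS CONTAIN THE SAME LITERAL CYLINDER**

Support file (Sahi cell, seat `prim-sahi-p1`, generation 37; `--supports stmt-CriticalPhenomena-4575`).  Pure proofs, no definitions, no `sorry`, standard axioms.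
Companion of `…SahiGridPatternTwoPayerCrossed` (same generation, same method).  `U = (x∧y) ∨ V ⊆ [3]^{2+k}` with the OR8 vector `e` of
`…TwoPayerSections.budget_twoPayer_sections`; `d` satisfies condition (N) of `…DiagCert` for the up-set `V` and is supported on `V`.
**THEOREM (`twoPayerSameLiteral_N`, every `k`):** condition (N) `Σ_{x∈B,y∈C} Θ_U(x,y) ≤ Σ_{x∈B∩C} e(x)` holds for all up-sets `B, C ⊇ {x ≥ 1}`.  With
`P_j = B_{(0,j)}`, `Q_j = C_{(0,j)}` (all other sections `[3]^k`) the proof is the identity (seat memo FROM-prim-sahi-p1-gen37-CROSSED-FAMILY-TRIPLE-COUNT, addendum)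
  `e(B∩C) − Θ_U(B×C) = 4·N_V[⊤,⊤] + 2·N_V[⊤,P_1∩Q_1] + 2·N_V[⊤,P_2∩Q_2] + 4·2^k·Σ_{j=0,1,2} |V ∖ (P_j ∪ Q_j)|`,
`N_V[⊤,S] = d(S) − 2^k|V∩S| ≥ 0` (found by the seat's symbolic LP, kit j271863; exact, denominator 1): `twoPayerSameLiteral_pair_identity` states the underlying
pair-sum identity for ARBITRARY integer functions, `twoPayerSameLiteral_columns_nonneg` the sign of its right-hand side.  Nothing here asserts `PatternPos d` for
`d ≥ 4` or condition (N) beyond this family. [this work]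
-/

namespace Summit.CriticalPhenomena.PercolationContinuityZ3.Theorems.SahiGridPattern

open Finset SahiGrid3
open scoped BigOperators

variable {k : ℕ}

/-- **The same-literal identity for the two-payer OR star, pair-sum form, ARBITRARY integer functions** `P₀ P₁ P₂ Q₀ Q₁ Q₂ V : [3]^k → ℤ`
(here written with `P_j = 1_B(0,j,·)`, `Q_j = 1_C(0,j,·)` for arbitrary finsets `B, C`). [this work] -/
theorem twoPayerSameLiteral_pair_identity (B C : Finset (Pd (1 + (1 + k)))) (V : Finset (Pd k)) :
    (∑ q : Pd k, ∑ r : Pd k, (if TotDist q r = true then (1:ℤ) else 0) *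
      ( (((4 * ind V q * ind B (glue (fun _ => 0) (glue (fun _ => 0) q)) * ind C (glue (fun _ => 0) (glue (fun _ => 0) q)) + 2 * ind V q * (ind B (glue (fun _ => 0) (glue (fun _ => 1) q)) * ind C (glue (fun _ => 0) (glue (fun _ => 1) q)) + ind B (glue (fun _ => 0) (glue (fun _ => 2) q)) * ind C (glue (fun _ => 0) (glue (fun _ => 2) q))) + 4 * ind V q + 16 + 12 * ind V q) - 12 * ind V r) - ( ind B (glue (fun _ => 0) (glue (fun _ => 0) q)) * (ind V q + 1 - 1)
          + ind B (glue (fun _ => 0) (glue (fun _ => 0) q)) * (ind V q + 1 - 1)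
          + ind B (glue (fun _ => 0) (glue (fun _ => 0) q)) * (ind V q + 1 - 1)
          + ind B (glue (fun _ => 0) (glue (fun _ => 0) q)) * (ind V q + 1 - 1)
          + ind B (glue (fun _ => 0) (glue (fun _ => 1) q)) * (ind V q + ind V r - 1)
          + ind B (glue (fun _ => 0) (glue (fun _ => 1) q)) * (ind V q + 1 - ind V (thirdPt q r))
          + ind B (glue (fun _ => 0) (glue (fun _ => 1) q)) * (ind V q + ind V r - 1)
          + ind B (glue (fun _ => 0) (glue (fun _ => 1) q)) * (ind V q + 1 - ind V (thirdPt q r))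
          + ind B (glue (fun _ => 0) (glue (fun _ => 2) q)) * (ind V q + ind V r - 1)
          + ind B (glue (fun _ => 0) (glue (fun _ => 2) q)) * (ind V q + 1 - ind V (thirdPt q r))
          + ind B (glue (fun _ => 0) (glue (fun _ => 2) q)) * (ind V q + ind V r - 1)
          + ind B (glue (fun _ => 0) (glue (fun _ => 2) q)) * (ind V q + 1 - ind V (thirdPt q r))
          + ind C (glue (fun _ => 0) (glue (fun _ => 1) r)) * (ind V q + ind V r - 1)
          + ind C (glue (fun _ => 0) (glue (fun _ => 2) r)) * (ind V q + ind V r - 1)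
          + (ind V q + 1 - ind V (thirdPt q r))
          + (ind V q + 1 - ind V (thirdPt q r))
          + ind C (glue (fun _ => 0) (glue (fun _ => 0) r)) * (1 + ind V r - 1)
          + ind C (glue (fun _ => 0) (glue (fun _ => 2) r)) * (1 + ind V r - ind V (thirdPt q r))
          + (1 + ind V r - ind V (thirdPt q r))
          + (1 + 1 - ind V (thirdPt q r))
          + ind C (glue (fun _ => 0) (glue (fun _ => 0) r)) * (1 + ind V r - 1)
          + ind C (glue (fun _ => 0) (glue (fun _ => 1) r)) * (1 + ind V r - ind V (thirdPt q r))
          + (1 + ind V r - ind V (thirdPt q r))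
          + (1 + 1 - ind V (thirdPt q r))
          + ind C (glue (fun _ => 0) (glue (fun _ => 1) r)) * (ind V q + ind V r - 1)
          + ind C (glue (fun _ => 0) (glue (fun _ => 2) r)) * (ind V q + ind V r - 1)
          + (ind V q + 1 - ind V (thirdPt q r))
          + (ind V q + 1 - ind V (thirdPt q r))
          + ind C (glue (fun _ => 0) (glue (fun _ => 0) r)) * (1 + ind V r - 1)
          + ind C (glue (fun _ => 0) (glue (fun _ => 2) r)) * (1 + ind V r - ind V (thirdPt q r))
          + (1 + ind V r - ind V (thirdPt q r))
          + (1 + 1 - ind V (thirdPt q r))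
          + ind C (glue (fun _ => 0) (glue (fun _ => 0) r)) * (1 + ind V r - 1)
          + ind C (glue (fun _ => 0) (glue (fun _ => 1) r)) * (1 + ind V r - ind V (thirdPt q r))
          + (1 + ind V r - ind V (thirdPt q r))
          + (1 + 1 - ind V (thirdPt q r)) )
        + (4 * (ind V q + ind V r - ind V (thirdPt q r)) + 2 * ((ind V q + ind V r - ind V (thirdPt q r)) * (ind B (glue (fun _ => 0) (glue (fun _ => 1) r)) * ind C (glue (fun _ => 0) (glue (fun _ => 1) r)))) + 2 * ((ind V q + ind V r - ind V (thirdPt q r)) * (ind B (glue (fun _ => 0) (glue (fun _ => 2) r)) * ind C (glue (fun _ => 0) (glue (fun _ => 2) r)))))) ))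
    = ∑ q : Pd k, ∑ r : Pd k, (if TotDist q r = true then (1:ℤ) else 0) *
      ( 4 * ind V q * ((1 - ind B (glue (fun _ => 0) (glue (fun _ => 0) q))) * (1 - ind C (glue (fun _ => 0) (glue (fun _ => 0) q))) + (1 - ind B (glue (fun _ => 0) (glue (fun _ => 1) q))) * (1 - ind C (glue (fun _ => 0) (glue (fun _ => 1) q))) + (1 - ind B (glue (fun _ => 0) (glue (fun _ => 2) q))) * (1 - ind C (glue (fun _ => 0) (glue (fun _ => 2) q)))) ) := by
  obtain ⟨c1, c2, c3, c4⟩ := And.intro (fun q r => (thirdPt_cancel (k := k) q r).1) (And.intro (fun q r => (thirdPt_cancel (k := k) q r).2.1)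
    (And.intro (fun q r => (thirdPt_cancel (k := k) q r).2.2.1) (fun q r => (thirdPt_cancel (k := k) q r).2.2.2)))
  exact pairSum_eq_of_sym6_eq _ _ (fun q r => by simp only [c1, c2, c3, c4, thirdPt_comm r q]; ring)

/-- The right-hand side columns are nonnegative (indicators). [this work] -/
theorem twoPayerSameLiteral_columns_nonneg (B C : Finset (Pd (1 + (1 + k)))) (V : Finset (Pd k)) :
    0 ≤ ∑ q : Pd k, ∑ r : Pd k, (if TotDist q r = true then (1:ℤ) else 0) *
      ( 4 * ind V q * ((1 - ind B (glue (fun _ => 0) (glue (fun _ => 0) q))) * (1 - ind C (glue (fun _ => 0) (glue (fun _ => 0) q))) + (1 - ind B (glue (fun _ => 0) (glue (fun _ => 1) q))) * (1 - ind C (glue (fun _ => 0) (glue (fun _ => 1) q))) + (1 - ind B (glue (fun _ => 0) (glue (fun _ => 2) q))) * (1 - ind C (glue (fun _ => 0) (glue (fun _ => 2) q)))) ) := by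
  refine Finset.sum_nonneg fun q _ => Finset.sum_nonneg fun r _ => mul_nonneg (by split_ifs <;> norm_num) ?_
  have hv := ind_nonneg' V q
  have a0 : 0 ≤ 1 - ind B (glue (fun _ => 0) (glue (fun _ => 0) q)) := by linarith [ind_le_one' B (glue (fun _ => 0) (glue (fun _ => 0) q))]
  have a1 : 0 ≤ 1 - ind B (glue (fun _ => 0) (glue (fun _ => 1) q)) := by linarith [ind_le_one' B (glue (fun _ => 0) (glue (fun _ => 1) q))]
  have a2 : 0 ≤ 1 - ind B (glue (fun _ => 0) (glue (fun _ => 2) q)) := by linarith [ind_le_one' B (glue (fun _ => 0) (glue (fun _ => 2) q))]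
  have b0 : 0 ≤ 1 - ind C (glue (fun _ => 0) (glue (fun _ => 0) q)) := by linarith [ind_le_one' C (glue (fun _ => 0) (glue (fun _ => 0) q))]
  have b1 : 0 ≤ 1 - ind C (glue (fun _ => 0) (glue (fun _ => 1) q)) := by linarith [ind_le_one' C (glue (fun _ => 0) (glue (fun _ => 1) q))]
  have b2 : 0 ≤ 1 - ind C (glue (fun _ => 0) (glue (fun _ => 2) q)) := by linarith [ind_le_one' C (glue (fun _ => 0) (glue (fun _ => 2) q))]
  have := mul_nonneg a0 b0; have := mul_nonneg a1 b1; have := mul_nonneg a2 b2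
  exact mul_nonneg (mul_nonneg (by norm_num) hv) (by linarith)

/-- **(N) FOR THE TWO-PAYER OR STAR WHEN `B, C ⊇ {x ≥ 1}`** (every `k`): top covers `N_V[⊤,⊤]`, `N_V[⊤,P_j∩Q_j]` for the `d`-part and
`twoPayerSameLiteral_pair_identity`. [this work] -/
theorem twoPayerSameLiteral_N {V : Finset (Pd k)} {U : Finset (Pd (1 + (1 + k)))}
    (hU : ∀ (ξ η : Pd 1) (q : Pd k), glue ξ (glue η q) ∈ U ↔ ((1 ≤ ξ 0 ∧ 1 ≤ η 0) ∨ q ∈ V))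
    (d : Pd k → ℤ) (hdV : ∀ q, q ∉ V → d q = 0)
    (hN : ∀ A A' : Finset (Pd k), IsUpperSet (A : Set (Pd k)) → IsUpperSet (A' : Set (Pd k)) →
      (∑ q ∈ A, ∑ r ∈ A', thetaVal V q r) ≤ ∑ q ∈ A ∩ A', d q)
    (B C : Finset (Pd (1 + (1 + k)))) (hB : IsUpperSet (B : Set (Pd (1 + (1 + k))))) (hC : IsUpperSet (C : Set (Pd (1 + (1 + k)))))
    (hBx : ∀ (ξ η : Pd 1) (q : Pd k), 1 ≤ ξ 0 → glue ξ (glue η q) ∈ B) (hCx : ∀ (ξ η : Pd 1) (q : Pd k), 1 ≤ ξ 0 → glue ξ (glue η q) ∈ C) :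
    (∑ x ∈ B, ∑ y ∈ C, thetaVal U x y) ≤ ∑ x ∈ B ∩ C, (fun x : Pd (1 + (1 + k)) =>
        if (1 ≤ freeOf x 0 ∧ 1 ≤ freeOf (cellOf x) 0) then (4 * 2 ^ k + 3 * (2 ^ k * ind V (cellOf (cellOf x)) - (nuCount V (cellOf (cellOf x)) : ℤ)))
        else if (freeOf x 0 = 0 ∧ freeOf (cellOf x) 0 = 0) then 4 * 2 ^ k * ind V (cellOf (cellOf x))
        else (2 * 2 ^ k + 2 * d (cellOf (cellOf x))) * ind V (cellOf (cellOf x))) x := by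
  have f12 : (1:Fin 3) ≤ 2 := by decide
  have b1 : ∀ (η : Pd 1) (q : Pd k), ind B (glue (fun _ => 1) (glue η q)) = 1 := fun η q => by
    unfold ind; rw [if_pos (hBx (fun _ => 1) η q le_rfl)]
  have b2 : ∀ (η : Pd 1) (q : Pd k), ind B (glue (fun _ => 2) (glue η q)) = 1 := fun η q => by
    unfold ind; rw [if_pos (hBx (fun _ => 2) η q f12)]
  have c1 : ∀ (η : Pd 1) (q : Pd k), ind C (glue (fun _ => 1) (glue η q)) = 1 := fun η q => by
    unfold ind; rw [if_pos (hCx (fun _ => 1) η q le_rfl)]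
  have c2 : ∀ (η : Pd 1) (q : Pd k), ind C (glue (fun _ => 2) (glue η q)) = 1 := fun η q => by
    unfold ind; rw [if_pos (hCx (fun _ => 2) η q f12)]
  rw [theta_twoPayer_sections hU B C, budget_twoPayer_sections V d B C]
  simp only [b1, b2, c1, c2, one_mul, mul_one]
  -- (1) budget
  have hE : (∑ q : Pd k, ( ind B (glue (fun _ => 0) (glue (fun _ => 0) q)) * ind C (glue (fun _ => 0) (glue (fun _ => 0) q)) * (4 * 2 ^ k * ind V q)
        + ind B (glue (fun _ => 0) (glue (fun _ => 1) q)) * ind C (glue (fun _ => 0) (glue (fun _ => 1) q)) * ((2 * 2 ^ k + 2 * d q) * ind V q)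
        + ind B (glue (fun _ => 0) (glue (fun _ => 2) q)) * ind C (glue (fun _ => 0) (glue (fun _ => 2) q)) * ((2 * 2 ^ k + 2 * d q) * ind V q)
        + ((2 * 2 ^ k + 2 * d q) * ind V q)
        + (4 * 2 ^ k + 3 * (2 ^ k * ind V q - (nuCount V q : ℤ)))
        + (4 * 2 ^ k + 3 * (2 ^ k * ind V q - (nuCount V q : ℤ)))
        + ((2 * 2 ^ k + 2 * d q) * ind V q)
        + (4 * 2 ^ k + 3 * (2 ^ k * ind V q - (nuCount V q : ℤ)))
        + (4 * 2 ^ k + 3 * (2 ^ k * ind V q - (nuCount V q : ℤ))) ))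
      = (∑ q : Pd k, ∑ r : Pd k, (if TotDist q r = true then (1:ℤ) else 0) * ((4 * ind V q * ind B (glue (fun _ => 0) (glue (fun _ => 0) q)) * ind C (glue (fun _ => 0) (glue (fun _ => 0) q)) + 2 * ind V q * (ind B (glue (fun _ => 0) (glue (fun _ => 1) q)) * ind C (glue (fun _ => 0) (glue (fun _ => 1) q)) + ind B (glue (fun _ => 0) (glue (fun _ => 2) q)) * ind C (glue (fun _ => 0) (glue (fun _ => 2) q))) + 4 * ind V q + 16 + 12 * ind V q) - 12 * ind V r)) + (∑ q : Pd k, (2 * d q * ind V q * (ind B (glue (fun _ => 0) (glue (fun _ => 1) q)) * ind C (glue (fun _ => 0) (glue (fun _ => 1) q)) + ind B (glue (fun _ => 0) (glue (fun _ => 2) q)) * ind C (glue (fun _ => 0) (glue (fun _ => 2) q))) + 4 * d q * ind V q)) := by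
    rw [← Finset.sum_add_distrib]
    refine Finset.sum_congr rfl fun q _ => ?_
    have h2 : (∑ r : Pd k, (if TotDist q r = true then (1:ℤ) else 0) * ((4 * ind V q * ind B (glue (fun _ => 0) (glue (fun _ => 0) q)) * ind C (glue (fun _ => 0) (glue (fun _ => 0) q)) + 2 * ind V q * (ind B (glue (fun _ => 0) (glue (fun _ => 1) q)) * ind C (glue (fun _ => 0) (glue (fun _ => 1) q)) + ind B (glue (fun _ => 0) (glue (fun _ => 2) q)) * ind C (glue (fun _ => 0) (glue (fun _ => 2) q))) + 4 * ind V q + 16 + 12 * ind V q) - 12 * ind V r)) = 2 ^ k * (4 * ind V q * ind B (glue (fun _ => 0) (glue (fun _ => 0) q)) * ind C (glue (fun _ => 0) (glue (fun _ => 0) q)) + 2 * ind V q * (ind B (glue (fun _ => 0) (glue (fun _ => 1) q)) * ind C (glue (fun _ => 0) (glue (fun _ => 1) q)) + ind B (glue (fun _ => 0) (glue (fun _ => 2) q)) * ind C (glue (fun _ => 0) (glue (fun _ => 2) q))) + 4 * ind V q + 16 + 12 * ind V q) - (nuCount V q : ℤ) * 12 := by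
      rw [show (∑ r : Pd k, (if TotDist q r = true then (1:ℤ) else 0) * ((4 * ind V q * ind B (glue (fun _ => 0) (glue (fun _ => 0) q)) * ind C (glue (fun _ => 0) (glue (fun _ => 0) q)) + 2 * ind V q * (ind B (glue (fun _ => 0) (glue (fun _ => 1) q)) * ind C (glue (fun _ => 0) (glue (fun _ => 1) q)) + ind B (glue (fun _ => 0) (glue (fun _ => 2) q)) * ind C (glue (fun _ => 0) (glue (fun _ => 2) q))) + 4 * ind V q + 16 + 12 * ind V q) - 12 * ind V r)) = (∑ r : Pd k, (if TotDist q r = true then (1:ℤ) else 0) * (4 * ind V q * ind B (glue (fun _ => 0) (glue (fun _ => 0) q)) * ind C (glue (fun _ => 0) (glue (fun _ => 0) q)) + 2 * ind V q * (ind B (glue (fun _ => 0) (glue (fun _ => 1) q)) * ind C (glue (fun _ => 0) (glue (fun _ => 1) q)) + ind B (glue (fun _ => 0) (glue (fun _ => 2) q)) * ind C (glue (fun _ => 0) (glue (fun _ => 2) q))) + 4 * ind V q + 16 + 12 * ind V q)) - ∑ r : Pd k, (if TotDist q r = true then (1:ℤ) else 0) * (ind V r * 12) by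
            rw [← Finset.sum_sub_distrib]; exact Finset.sum_congr rfl fun r _ => by ring]
      rw [← Finset.sum_mul, sum_ite_totDist_eq_two_pow, ← nuCount_mul_eq_pairSum V (fun _ => (12:ℤ)) q]
    rw [h2]
    ring
  -- (2) sections and covers
  have hPind : ∀ (c : Fin 3) (q : Pd k), ind (sect (sect B (fun _ : Fin 1 => (0:Fin 3))) (fun _ : Fin 1 => c)) q
      = ind B (glue (fun _ => 0) (glue (fun _ => c) q)) := fun c q => by rw [ind_sect, ind_sect]
  have hQind : ∀ (c : Fin 3) (q : Pd k), ind (sect (sect C (fun _ : Fin 1 => (0:Fin 3))) (fun _ : Fin 1 => c)) q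
      = ind C (glue (fun _ => 0) (glue (fun _ => c) q)) := fun c q => by rw [ind_sect, ind_sect]
  have hdv : ∀ q : Pd k, d q * ind V q = d q := fun q => by
    unfold ind
    by_cases hq : q ∈ V
    · rw [if_pos hq, mul_one]
    · rw [if_neg hq, mul_zero, hdV q hq]
  have huniv : IsUpperSet ((Finset.univ : Finset (Pd k)) : Set (Pd k)) := by
    rw [Finset.coe_univ]; exact isUpperSet_univ
  have cover0 : (∑ q : Pd k, ∑ r : Pd k, (if TotDist q r = true then (1:ℤ) else 0) * (ind V q + ind V r - ind V (thirdPt q r))) ≤ ∑ q : Pd k, d q := by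
    have n0 := hN Finset.univ Finset.univ huniv huniv
    rw [Finset.univ_inter] at n0
    have e0 : (∑ q ∈ (Finset.univ : Finset (Pd k)), ∑ r ∈ (Finset.univ : Finset (Pd k)), thetaVal V q r) = (∑ q : Pd k, ∑ r : Pd k, (if TotDist q r = true then (1:ℤ) else 0) * (ind V q + ind V r - ind V (thirdPt q r))) :=
      Finset.sum_congr rfl fun q _ => Finset.sum_congr rfl fun r _ => by rw [thetaVal_eq_ite_mul]
    rw [← e0]; exact n0
  have coverj : ∀ c : Fin 3, (∑ q : Pd k, ∑ r : Pd k, (if TotDist q r = true then (1:ℤ) else 0) * ((ind V q + ind V r - ind V (thirdPt q r)) * (ind B (glue (fun _ => 0) (glue (fun _ => c) r)) * ind C (glue (fun _ => 0) (glue (fun _ => c) r)))))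
      ≤ ∑ q : Pd k, d q * (ind B (glue (fun _ => 0) (glue (fun _ => c) q)) * ind C (glue (fun _ => 0) (glue (fun _ => c) q))) := by
    intro c
    have hS : IsUpperSet (((sect (sect B (fun _ : Fin 1 => (0:Fin 3))) (fun _ : Fin 1 => c) ∩ sect (sect C (fun _ : Fin 1 => (0:Fin 3))) (fun _ : Fin 1 => c)) : Finset (Pd k)) : Set (Pd k)) := by
      rw [Finset.coe_inter]; exact (isUpperSet_sect (isUpperSet_sect hB _) _).inter (isUpperSet_sect (isUpperSet_sect hC _) _)
    have n1 := hN Finset.univ _ huniv hS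
    rw [Finset.univ_inter] at n1
    have e1 : (∑ q ∈ (Finset.univ : Finset (Pd k)), ∑ r ∈ (sect (sect B (fun _ : Fin 1 => (0:Fin 3))) (fun _ : Fin 1 => c) ∩ sect (sect C (fun _ : Fin 1 => (0:Fin 3))) (fun _ : Fin 1 => c)), thetaVal V q r)
        = ∑ q : Pd k, ∑ r : Pd k, (if TotDist q r = true then (1:ℤ) else 0) * ((ind V q + ind V r - ind V (thirdPt q r)) * (ind B (glue (fun _ => 0) (glue (fun _ => c) r)) * ind C (glue (fun _ => 0) (glue (fun _ => c) r)))) := by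
      refine Finset.sum_congr rfl fun q _ => ?_
      rw [sum_mem_eq_sum_ind_mul (sect (sect B (fun _ : Fin 1 => (0:Fin 3))) (fun _ : Fin 1 => c) ∩ sect (sect C (fun _ : Fin 1 => (0:Fin 3))) (fun _ : Fin 1 => c))]
      refine Finset.sum_congr rfl fun r _ => ?_
      rw [ind_inter_eq_mul, hPind, hQind, thetaVal_eq_ite_mul]; ring
    have e2 : (∑ q ∈ (sect (sect B (fun _ : Fin 1 => (0:Fin 3))) (fun _ : Fin 1 => c) ∩ sect (sect C (fun _ : Fin 1 => (0:Fin 3))) (fun _ : Fin 1 => c)), d q)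
        = ∑ q : Pd k, d q * (ind B (glue (fun _ => 0) (glue (fun _ => c) q)) * ind C (glue (fun _ => 0) (glue (fun _ => c) q))) := by
      rw [sum_mem_eq_sum_ind_mul (sect (sect B (fun _ : Fin 1 => (0:Fin 3))) (fun _ : Fin 1 => c) ∩ sect (sect C (fun _ : Fin 1 => (0:Fin 3))) (fun _ : Fin 1 => c))]
      refine Finset.sum_congr rfl fun q _ => ?_
      rw [ind_inter_eq_mul, hPind, hQind]; ring
    rw [← e1, ← e2]; exact n1
  have hD : 4 * (∑ q : Pd k, ∑ r : Pd k, (if TotDist q r = true then (1:ℤ) else 0) * (ind V q + ind V r - ind V (thirdPt q r))) + 2 * (∑ q : Pd k, ∑ r : Pd k, (if TotDist q r = true then (1:ℤ) else 0) * ((ind V q + ind V r - ind V (thirdPt q r)) * (ind B (glue (fun _ => 0) (glue (fun _ => 1) r)) * ind C (glue (fun _ => 0) (glue (fun _ => 1) r))))) + 2 * (∑ q : Pd k, ∑ r : Pd k, (if TotDist q r = true then (1:ℤ) else 0) * ((ind V q + ind V r - ind V (thirdPt q r)) * (ind B (glue (fun _ => 0) (glue (fun _ => 2) r)) * ind C (glue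 (fun _ => 0) (glue (fun _ => 2) r)))))
      ≤ (∑ q : Pd k, (2 * d q * ind V q * (ind B (glue (fun _ => 0) (glue (fun _ => 1) q)) * ind C (glue (fun _ => 0) (glue (fun _ => 1) q)) + ind B (glue (fun _ => 0) (glue (fun _ => 2) q)) * ind C (glue (fun _ => 0) (glue (fun _ => 2) q))) + 4 * d q * ind V q)) := by
    have s0 := cover0; have s1 := coverj 1; have s2 := coverj 2
    have eD : (∑ q : Pd k, (2 * d q * ind V q * (ind B (glue (fun _ => 0) (glue (fun _ => 1) q)) * ind C (glue (fun _ => 0) (glue (fun _ => 1) q)) + ind B (glue (fun _ => 0) (glue (fun _ => 2) q)) * ind C (glue (fun _ => 0) (glue (fun _ => 2) q))) + 4 * d q * ind V q))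
        = 2 * (∑ q : Pd k, d q * (ind B (glue (fun _ => 0) (glue (fun _ => 1) q)) * ind C (glue (fun _ => 0) (glue (fun _ => 1) q)))) + 2 * (∑ q : Pd k, d q * (ind B (glue (fun _ => 0) (glue (fun _ => 2) q)) * ind C (glue (fun _ => 0) (glue (fun _ => 2) q)))) + 4 * (∑ q : Pd k, d q) := by
      rw [Finset.mul_sum, Finset.mul_sum, Finset.mul_sum, ← Finset.sum_add_distrib, ← Finset.sum_add_distrib]
      refine Finset.sum_congr rfl fun q _ => ?_
      have := hdv q
      have e' : 2 * d q * ind V q = 2 * d q := by rw [mul_assoc, this]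
      have e'' : 4 * d q * ind V q = 4 * d q := by rw [mul_assoc, this]
      rw [e', e'']; ring
    rw [eD]
    linarith [s0, s1, s2]
  -- (3) identity, columns, assembly
  have Id := twoPayerSameLiteral_pair_identity B C V
  have hG := twoPayerSameLiteral_columns_nonneg B C V
  have split : ((∑ q : Pd k, ∑ r : Pd k, (if TotDist q r = true then (1:ℤ) else 0) * ((4 * ind V q * ind B (glue (fun _ => 0) (glue (fun _ => 0) q)) * ind C (glue (fun _ => 0) (glue (fun _ => 0) q)) + 2 * ind V q * (ind B (glue (fun _ => 0) (glue (fun _ => 1) q)) * ind C (glue (fun _ => 0) (glue (fun _ => 1) q)) + ind B (glue (fun _ => 0) (glue (fun _ => 2) q)) * ind C (glue (fun _ => 0) (glue (fun _ => 2) q))) + 4 * ind V q + 16 + 12 * ind V q) - 12 * ind V r))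
      - (∑ q : Pd k, ∑ r : Pd k, (if TotDist q r = true then (1:ℤ) else 0) * ( ind B (glue (fun _ => 0) (glue (fun _ => 0) q)) * (ind V q + 1 - 1)
          + ind B (glue (fun _ => 0) (glue (fun _ => 0) q)) * (ind V q + 1 - 1)
          + ind B (glue (fun _ => 0) (glue (fun _ => 0) q)) * (ind V q + 1 - 1)
          + ind B (glue (fun _ => 0) (glue (fun _ => 0) q)) * (ind V q + 1 - 1)
          + ind B (glue (fun _ => 0) (glue (fun _ => 1) q)) * (ind V q + ind V r - 1)
          + ind B (glue (fun _ => 0) (glue (fun _ => 1) q)) * (ind V q + 1 - ind V (thirdPt q r))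
          + ind B (glue (fun _ => 0) (glue (fun _ => 1) q)) * (ind V q + ind V r - 1)
          + ind B (glue (fun _ => 0) (glue (fun _ => 1) q)) * (ind V q + 1 - ind V (thirdPt q r))
          + ind B (glue (fun _ => 0) (glue (fun _ => 2) q)) * (ind V q + ind V r - 1)
          + ind B (glue (fun _ => 0) (glue (fun _ => 2) q)) * (ind V q + 1 - ind V (thirdPt q r))
          + ind B (glue (fun _ => 0) (glue (fun _ => 2) q)) * (ind V q + ind V r - 1)
          + ind B (glue (fun _ => 0) (glue (fun _ => 2) q)) * (ind V q + 1 - ind V (thirdPt q r))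
          + ind C (glue (fun _ => 0) (glue (fun _ => 1) r)) * (ind V q + ind V r - 1)
          + ind C (glue (fun _ => 0) (glue (fun _ => 2) r)) * (ind V q + ind V r - 1)
          + (ind V q + 1 - ind V (thirdPt q r))
          + (ind V q + 1 - ind V (thirdPt q r))
          + ind C (glue (fun _ => 0) (glue (fun _ => 0) r)) * (1 + ind V r - 1)
          + ind C (glue (fun _ => 0) (glue (fun _ => 2) r)) * (1 + ind V r - ind V (thirdPt q r))
          + (1 + ind V r - ind V (thirdPt q r))
          + (1 + 1 - ind V (thirdPt q r))
          + ind C (glue (fun _ => 0) (glue (fun _ => 0) r)) * (1 + ind V r - 1)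
          + ind C (glue (fun _ => 0) (glue (fun _ => 1) r)) * (1 + ind V r - ind V (thirdPt q r))
          + (1 + ind V r - ind V (thirdPt q r))
          + (1 + 1 - ind V (thirdPt q r))
          + ind C (glue (fun _ => 0) (glue (fun _ => 1) r)) * (ind V q + ind V r - 1)
          + ind C (glue (fun _ => 0) (glue (fun _ => 2) r)) * (ind V q + ind V r - 1)
          + (ind V q + 1 - ind V (thirdPt q r))
          + (ind V q + 1 - ind V (thirdPt q r))
          + ind C (glue (fun _ => 0) (glue (fun _ => 0) r)) * (1 + ind V r - 1)
          + ind C (glue (fun _ => 0) (glue (fun _ => 2) r)) * (1 + ind V r - ind V (thirdPt q r))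
          + (1 + ind V r - ind V (thirdPt q r))
          + (1 + 1 - ind V (thirdPt q r))
          + ind C (glue (fun _ => 0) (glue (fun _ => 0) r)) * (1 + ind V r - 1)
          + ind C (glue (fun _ => 0) (glue (fun _ => 1) r)) * (1 + ind V r - ind V (thirdPt q r))
          + (1 + ind V r - ind V (thirdPt q r))
          + (1 + 1 - ind V (thirdPt q r)) ))
      + (4 * (∑ q : Pd k, ∑ r : Pd k, (if TotDist q r = true then (1:ℤ) else 0) * (ind V q + ind V r - ind V (thirdPt q r))) + 2 * (∑ q : Pd k, ∑ r : Pd k, (if TotDist q r = true then (1:ℤ) else 0) * ((ind V q + ind V r - ind V (thirdPt q r)) * (ind B (glue (fun _ => 0) (glue (fun _ => 1) r)) * ind C (glue (fun _ => 0) (glue (fun _ => 1) r))))) + 2 * (∑ q : Pd k, ∑ r : Pd k, (if TotDist q r = true then (1:ℤ) else 0) * ((ind V q + ind V r - ind V (thirdPt q r)) * (ind B (glue (fun _ => 0) (glue (fun _ => 2) r)) * ind C (glue (fun _ => 0) (glue (fun _ => 2) r)))))))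
      = ∑ q : Pd k, ∑ r : Pd k, (if TotDist q r = true then (1:ℤ) else 0) * ((((4 * ind V q * ind B (glue (fun _ => 0) (glue (fun _ => 0) q)) * ind C (glue (fun _ => 0) (glue (fun _ => 0) q)) + 2 * ind V q * (ind B (glue (fun _ => 0) (glue (fun _ => 1) q)) * ind C (glue (fun _ => 0) (glue (fun _ => 1) q)) + ind B (glue (fun _ => 0) (glue (fun _ => 2) q)) * ind C (glue (fun _ => 0) (glue (fun _ => 2) q))) + 4 * ind V q + 16 + 12 * ind V q) - 12 * ind V r) - ( ind B (glue (fun _ => 0) (glue (fun _ => 0) q)) * (ind V q + 1 - 1)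
          + ind B (glue (fun _ => 0) (glue (fun _ => 0) q)) * (ind V q + 1 - 1)
          + ind B (glue (fun _ => 0) (glue (fun _ => 0) q)) * (ind V q + 1 - 1)
          + ind B (glue (fun _ => 0) (glue (fun _ => 0) q)) * (ind V q + 1 - 1)
          + ind B (glue (fun _ => 0) (glue (fun _ => 1) q)) * (ind V q + ind V r - 1)
          + ind B (glue (fun _ => 0) (glue (fun _ => 1) q)) * (ind V q + 1 - ind V (thirdPt q r))
          + ind B (glue (fun _ => 0) (glue (fun _ => 1) q)) * (ind V q + ind V r - 1)
          + ind B (glue (fun _ => 0) (glue (fun _ => 1) q)) * (ind V q + 1 - ind V (thirdPt q r))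
          + ind B (glue (fun _ => 0) (glue (fun _ => 2) q)) * (ind V q + ind V r - 1)
          + ind B (glue (fun _ => 0) (glue (fun _ => 2) q)) * (ind V q + 1 - ind V (thirdPt q r))
          + ind B (glue (fun _ => 0) (glue (fun _ => 2) q)) * (ind V q + ind V r - 1)
          + ind B (glue (fun _ => 0) (glue (fun _ => 2) q)) * (ind V q + 1 - ind V (thirdPt q r))
          + ind C (glue (fun _ => 0) (glue (fun _ => 1) r)) * (ind V q + ind V r - 1)
          + ind C (glue (fun _ => 0) (glue (fun _ => 2) r)) * (ind V q + ind V r - 1)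
          + (ind V q + 1 - ind V (thirdPt q r))
          + (ind V q + 1 - ind V (thirdPt q r))
          + ind C (glue (fun _ => 0) (glue (fun _ => 0) r)) * (1 + ind V r - 1)
          + ind C (glue (fun _ => 0) (glue (fun _ => 2) r)) * (1 + ind V r - ind V (thirdPt q r))
          + (1 + ind V r - ind V (thirdPt q r))
          + (1 + 1 - ind V (thirdPt q r))
          + ind C (glue (fun _ => 0) (glue (fun _ => 0) r)) * (1 + ind V r - 1)
          + ind C (glue (fun _ => 0) (glue (fun _ => 1) r)) * (1 + ind V r - ind V (thirdPt q r))
          + (1 + ind V r - ind V (thirdPt q r))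
          + (1 + 1 - ind V (thirdPt q r))
          + ind C (glue (fun _ => 0) (glue (fun _ => 1) r)) * (ind V q + ind V r - 1)
          + ind C (glue (fun _ => 0) (glue (fun _ => 2) r)) * (ind V q + ind V r - 1)
          + (ind V q + 1 - ind V (thirdPt q r))
          + (ind V q + 1 - ind V (thirdPt q r))
          + ind C (glue (fun _ => 0) (glue (fun _ => 0) r)) * (1 + ind V r - 1)
          + ind C (glue (fun _ => 0) (glue (fun _ => 2) r)) * (1 + ind V r - ind V (thirdPt q r))
          + (1 + ind V r - ind V (thirdPt q r))
          + (1 + 1 - ind V (thirdPt q r))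
          + ind C (glue (fun _ => 0) (glue (fun _ => 0) r)) * (1 + ind V r - 1)
          + ind C (glue (fun _ => 0) (glue (fun _ => 1) r)) * (1 + ind V r - ind V (thirdPt q r))
          + (1 + ind V r - ind V (thirdPt q r))
          + (1 + 1 - ind V (thirdPt q r)) )
        + (4 * (ind V q + ind V r - ind V (thirdPt q r)) + 2 * ((ind V q + ind V r - ind V (thirdPt q r)) * (ind B (glue (fun _ => 0) (glue (fun _ => 1) r)) * ind C (glue (fun _ => 0) (glue (fun _ => 1) r)))) + 2 * ((ind V q + ind V r - ind V (thirdPt q r)) * (ind B (glue (fun _ => 0) (glue (fun _ => 2) r)) * ind C (glue (fun _ => 0) (glue (fun _ => 2) r))))))) := by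
    simp only [Finset.mul_sum, ← Finset.sum_add_distrib, ← Finset.sum_sub_distrib]
    refine Finset.sum_congr rfl fun q _ => Finset.sum_congr rfl fun r _ => ?_
    ring
  rw [hE]
  linarith [hD, Id, hG, split]

end Summit.CriticalPhenomena.PercolationContinuityZ3.Theorems.SahiGridPattern
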